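import Summits.ValiantsHypothesis.ValiantsHypothesis.Theorems.LacunarySymmetroidMatrixDescartesCensusV20Check

/-!
# `MatrixDescartes` census — a kernel-evaluable CHECKER for the CASE-C (`V = 19`, one-collision) certificates (definitions)

HONEST FRAMING.  Object-search cell `pub-symmetroid`; door-A item `DoorA26 = PosRootLawAt 2 6 19`
(stmt-ValiantsHypothesis-19979; OPEN, typed, never asserted) and its sharper support rows `PosRootLawOn 2 6 18 d`.  DEFINITIONS ONLY:
the certificate language and Boolean checker (`V19C.checkSupport`, `V19C.tableOK`, cover checks `V19C.coverSlicesX`) for engine-3 g15's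
CASE-C certificates (`casec.py`, kit j236533 `C_<d₅>.jsonl`; re-derived and validated EXACTLY by val-sym-door-p5 g3's independent code,
export `HOME/val-sym-door-p5/g3/work/casec/export/`, spec `CASEC-REFLECT-SPEC.md`), extending this seat's `V = 20` checker `…CensusV20Check`
(whose atoms, named inequalities `G3 / RCS / W`, rows, factored constants and Newton-cone rows are reused verbatim).  Nothing is proved here:
semantics in `…CensusV19CModel`, soundness in `…CensusV19CSound*`, data (kernel replays by `decide +kernel`) in `…CensusV19CBox18*`.
WHAT IS CHECKED.  A one-collision support `d = [d₀,…,d₅]` has `20` distinct pair sums: exactly one sum `e⋆` is hit by two atoms `A, B`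
(`A` = the later of the two in the sorted atom list `V20.sortAtoms d`, position `p⋆`; the order and the single tie are VERIFIED by `ordOK`).
A hypothetical pencil with `19` distinct positive det-roots on `d` is Descartes-sharp on the `20` sums (all `20` coefficients non-zero and
alternating; orientation `s` = sign of the lowest), its coefficient at `e⋆` is the composite `c⋆ = G_A + G_B`, and `(G_A, G_B, c⋆)` falls in one
of six BRANCHES `ZA` (`G_A = 0`) · `ZB` (`G_B = 0`) · `PPa` · `PPb` (both of the sign of `c⋆`, `|G_B| ≤ |G_A| ≤ |c⋆| ≤ 2|G_A|` resp. swapped) ·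
`PM` · `MP` (`G_A` of the sign of `c⋆`, `G_B` opposite, `|G_B| ≤ |G_A|`, `|c⋆| ≤ |G_A|`, resp. swapped) — `Census.caseC_dispatch` (…CaseCKit,
val-sym-door-p5 g3).  A CELL is `(d, s, branch)`; its `22` SLOTS are the `20` coefficient magnitudes (slot `t < 20` = position `t`, slot `p⋆` =
`|c⋆|`), `|G_A|` (slot `20`) and `|G_B|` (slot `21`); atom `↦` slot is `posOf · ordS` for the slot list `ordS`; each slot carries a three-valued
sign (position parity / branch sign / zero).  Rows are monomial inequalities in the slot magnitudes: Newton-cone rows `C25` through positions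
`t − 1, t, t + 1` of the `20` sums (`1 ≤ t ≤ 18`), the branch's LINK rows, and single-positive-term / AM–GM rows of `G3, RCS, W ≥ 0` after deleting
the terms that contain the branch's zero atom.  Certificates: odd definite triangle (`sign`), odd triangle through one NULL letter (`signNull`),
an inequality all of whose surviving terms are negative (`allneg`), a Farkas combination (`lp`), a single-monomial domination (`dom`).  A support
passes when all `12` cells (`2` orientations × `6` branches) carry accepted certificates.  Nothing here bears on the `2`-Sidon supports, on
`ζ_sym(2,6)` over all supports, on `MatrixDescartes` (stmt-ValiantsHypothesis-18050) or on `VP ≠ VNP`.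

[folklore] Bookkeeping / certificate replay; elementary.
-/

-- the D-0017 layout repeats a namespace component (single-conjunct summit); the `dupNamespace` linter flags it; name mandated.
set_option linter.dupNamespace false

namespace Summit.ValiantsHypothesis.ValiantsHypothesis.Theorems.LacunarySymmetroidMatrixDescartes.Census.V19C

open V20 (Atom allAtoms psum sortAtoms posOf qA cA Term PolySpec posl oddTrues FNat fval Row dist1 rowC25 rowOne rowAmgm
  bump bumps FRat insZ mulF divF numZ denZ negAt incLists psums6 mirror keysTop)

/-! ## The order with one tie, the slots -/

/-- Index of the first adjacent pair of atoms with equal pair sums (`= length − 1` or more if none). [folklore] -/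
def findTie (d : List ℕ) : List Atom → ℕ
  | [] => 0
  | a :: l =>
    match l with
    | [] => 0
    | b :: _ => if psum d a = psum d b then 0 else findTie d l + 1

/-- The order check of a one-collision support: `ord` lists all `21` atoms, positions `pstar`, `pstar + 1` have the same pair sum, and
with position `pstar + 1` removed the pair sums increase strictly (so exactly `20` distinct sums). [folklore] -/
def ordOK (d : List ℕ) (ord : List Atom) (pstar : ℕ) : Bool :=
  decide (d.length = 6) && decide (ord.length = 21) && decide (∀ a ∈ allAtoms, a ∈ ord) && decide (∀ b ∈ ord, b ∈ allAtoms) &&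
    decide (pstar + 1 < 21) && decide (psum d (ord.getD pstar (0, 0)) = psum d (ord.getD (pstar + 1) (0, 0))) &&
    decide ((ord.eraseIdx (pstar + 1)).Pairwise (fun a b => psum d a < psum d b))

/-- The six branches of the composite coefficient `c⋆ = G_A + G_B`. [folklore] -/
inductive Br where
  /-- `G_A = 0` -/ | ZA
  /-- `G_B = 0` -/ | ZB
  /-- both of the sign of `c⋆`, `|G_B| ≤ |G_A|` -/ | PPa
  /-- both of the sign of `c⋆`, `|G_A| ≤ |G_B|` -/ | PPb
  /-- `G_A` of the sign of `c⋆`, `G_B` opposite -/ | PM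
  /-- `G_B` of the sign of `c⋆`, `G_A` opposite -/ | MP
  deriving DecidableEq

/-- All six branches. [folklore] -/
def allBr : List Br := [.ZA, .ZB, .PPa, .PPb, .PM, .MP]

/-- A cell context: support, slot list (index = slot; the dummy `(6,6)` occupies slot `p⋆`), the `20` sums, orientation, branch, `p⋆`. [folklore] -/
structure Ctx where
  /-- the support -/
  d : List ℕ
  /-- slot list: the `20` atoms by increasing sum with `A` replaced by `(6,6)`, then `A`, `B` -/
  ordS : List Atom
  /-- the `20` distinct pair sums, increasing -/
  E : List ℕ
  /-- orientation: lowest coefficient positive -/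
  s : Bool
  /-- branch -/
  br : Br
  /-- position of the collided sum -/
  pstar : ℕ

/-- The context of the cell `(d, s, br)` from a verified order. [folklore] -/
def mkCtx (d : List ℕ) (ord : List Atom) (pstar : ℕ) (s : Bool) (br : Br) : Ctx :=
  let o20 := ord.eraseIdx (pstar + 1)
  { d := d, ordS := o20.set pstar (6, 6) ++ [ord.getD pstar (0, 0), ord.getD (pstar + 1) (0, 0)], E := o20.map (psum d),
    s := s, br := br, pstar := pstar }

/-- Is slot `k` the branch's ZERO atom (`G_A` in `ZA`, `G_B` in `ZB`)? [folklore] -/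
def zeroSlot (br : Br) (k : ℕ) : Bool := (k == 20 && decide (br = .ZA)) || (k == 21 && decide (br = .ZB))

/-- Is slot `k` NEGATIVE?  Positions alternate (`s·(−1)^t`); `G_A` has the sign of position `p⋆` except in `MP`, `G_B` except in `PM`. [folklore] -/
def negSlot (s : Bool) (br : Br) (pstar k : ℕ) : Bool :=
  if k < 20 then negAt s k else if k = 20 then xor (decide (br = .MP)) (negAt s pstar) else xor (decide (br = .PM)) (negAt s pstar)

/-- Slot of an atom. [folklore] -/
def Ctx.slot (c : Ctx) (a : Atom) : ℕ := posOf a c.ordS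

/-- Does the term contain the zero atom? [folklore] -/
def termZero (c : Ctx) (T : Term) : Bool := T.2.any fun a => zeroSlot c.br (c.slot a)

/-- Is the (non-zero) term NEGATIVE under the cell's signs? [folklore] -/
def termNeg (c : Ctx) (T : Term) : Bool :=
  xor (decide (T.1 < 0)) (oddTrues (T.2.map fun a => negSlot c.s c.br c.pstar (c.slot a)))

/-- Is the atom strictly POSITIVE (neither zero nor negative)? [folklore] -/
def atomPos (c : Ctx) (a : Atom) : Bool := !zeroSlot c.br (c.slot a) && !negSlot c.s c.br c.pstar (c.slot a)

/-- Is the atom the zero atom? [folklore] -/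
def atomZero (c : Ctx) (a : Atom) : Bool := zeroSlot c.br (c.slot a)

/-- Indices of the terms of `P` that are non-zero and POSITIVE. [folklore] -/
def posTerms (c : Ctx) (P : List Term) : List ℕ :=
  (List.range P.length).filter fun n => match P[n]? with
    | some T => !termZero c T && !termNeg c T
    | none => false

/-- Side condition of a named inequality: `RCS(i,j)` needs letter `i` definite (atom `q i` strictly positive). [folklore] -/
def defOK (c : Ctx) : PolySpec → Bool
  | .rcs i _ => atomPos c (qA i)
  | _ => true

/-- Validity of an inequality for row extraction (indices, side condition, exactly one non-zero positive term); returns its index. [folklore] -/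
def posIndex (c : Ctx) (P : PolySpec) : Option ℕ :=
  if P.valid && defOK c P then
    match posTerms c P.poly with
    | [p] => some p
    | _ => none
  else none

/-! ## Rows -/

/-- The three magnitudes a LINK row may compare. [folklore] -/
inductive LinkVar where
  /-- `|c⋆|` (slot `p⋆`) -/ | cs
  /-- `|G_A|` (slot `20`) -/ | ga
  /-- `|G_B|` (slot `21`) -/ | gb
  deriving DecidableEq

/-- Slot of a link variable. [folklore] -/
def LinkVar.slot (pstar : ℕ) : LinkVar → ℕ
  | .cs => pstar
  | .ga => 20
  | .gb => 21

/-- The LINK rows `|small| ≤ factor · |large|` licensed by a branch. [folklore] -/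
def linkOK (br : Br) (sm : LinkVar) (f : ℕ) (lg : LinkVar) : Bool :=
  match br with
  | .ZA => (decide (sm = .cs) && f == 1 && decide (lg = .gb)) || (decide (sm = .gb) && f == 1 && decide (lg = .cs))
  | .ZB => (decide (sm = .cs) && f == 1 && decide (lg = .ga)) || (decide (sm = .ga) && f == 1 && decide (lg = .cs))
  | .PPa => (decide (sm = .gb) && f == 1 && decide (lg = .ga)) || (decide (sm = .ga) && f == 1 && decide (lg = .cs)) ||
      (decide (sm = .cs) && f == 2 && decide (lg = .ga))
  | .PPb => (decide (sm = .ga) && f == 1 && decide (lg = .gb)) || (decide (sm = .gb) && f == 1 && decide (lg = .cs)) ||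
      (decide (sm = .cs) && f == 2 && decide (lg = .gb))
  | .PM => (decide (sm = .gb) && f == 1 && decide (lg = .ga)) || (decide (sm = .cs) && f == 1 && decide (lg = .ga))
  | .MP => (decide (sm = .ga) && f == 1 && decide (lg = .gb)) || (decide (sm = .cs) && f == 1 && decide (lg = .gb))

/-- The LINK row `x_small · 1 ≤ x_large · factor`. [folklore] -/
def rowLink (pstar : ℕ) (sm : LinkVar) (f : ℕ) (lg : LinkVar) : Row :=
  { L := [sm.slot pstar], R := [lg.slot pstar], Bnum := [(f, 1)], Bden := [] }

/-- Row specifications a Case-C certificate may use. [folklore] -/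
inductive RowSpec where
  /-- Newton-cone row through positions `t−1, t, t+1` of the `20` sums -/
  | c25 (t : ℕ)
  /-- branch LINK row -/
  | link (sm : LinkVar) (f : ℕ) (lg : LinkVar)
  /-- `|tₙ| ≤ t₊` from the single-positive inequality `P` (term `n` non-zero) -/
  | one (P : PolySpec) (n : ℕ)
  /-- AM–GM over the non-zero negative terms `S` of the single-positive inequality `P` -/
  | amgm (P : PolySpec) (S : List ℕ)

/-- Build a row from its specification, checking its side conditions. [folklore] -/
def buildRow (c : Ctx) : RowSpec → Option Row
  | .c25 t => if 1 ≤ t ∧ t ≤ 18 then some (rowC25 c.E t) else none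
  | .link sm f lg => if linkOK c.br sm f lg then some (rowLink c.pstar sm f lg) else none
  | .one P n =>
    match posIndex c P with
    | some p => if decide (n < P.poly.length ∧ n ≠ p) && !termZero c (P.poly.getD n (0, [])) then some (rowOne c.ordS P.poly p n) else none
    | none => none
  | .amgm P S =>
    match posIndex c P with
    | some p =>
      if decide (∀ j ∈ S, j < P.poly.length ∧ j ≠ p) && S.all (fun j => !termZero c (P.poly.getD j (0, []))) &&
          decide S.Nodup && decide (S ≠ []) then
        some (rowAmgm c.ordS P.poly p S) else none
    | none => none

/-- Build all rows of a list of specifications (with multipliers); `none` if one is invalid. [folklore] -/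
def buildRows (c : Ctx) : List (RowSpec × ℕ) → Option (List (Row × ℕ))
  | [] => some []
  | (rs, n) :: rest =>
    match buildRow c rs, buildRows c rest with
    | some r, some rr => some ((r, n) :: rr)
    | _, _ => none

/-! ## Exponent balance over `22` slots -/

/-- The zero count vector over the `22` slots. [folklore] -/
def zero22 : List ℕ := List.replicate 22 0

/-- Accumulated Farkas product of rows with natural multipliers over `22` slots (as `V20.accumulate`). [folklore] -/
def accumulate (rows : List (Row × ℕ)) : List ℕ × List ℕ × FRat :=
  rows.foldl (fun acc rn =>
      (bumps acc.1 rn.1.L rn.2, bumps acc.2.1 rn.1.R rn.2, divF (mulF acc.2.2 rn.1.Bden rn.2) rn.1.Bnum rn.2))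
    (zero22, zero22, [])

/-! ## Certificates -/

/-- A competitor of a domination certificate (as `V20.Comp`, with Case-C rows). [folklore] -/
structure Comp where
  /-- index of the positive term -/
  k : ℕ
  /-- rows with multipliers -/
  rows : List (RowSpec × ℕ)
  /-- root degree -/
  D : ℕ
  /-- numerator of the bound -/
  un : ℕ

/-- Certificates that a cell `(d, s, br)` carries no nineteen. [folklore] -/
inductive Cert where
  /-- odd triangle through three definite letters `i < j < k` -/
  | sign (i j k : ℕ)
  /-- odd triangle through the NULL letter `n` and definite letters `a < b` -/
  | signNull (n a b : ℕ)
  /-- every non-zero term of the inequality `P ≥ 0` is negative -/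
  | allneg (P : PolySpec)
  /-- Farkas combination of rows -/
  | lp (rows : List (RowSpec × ℕ))
  /-- single-monomial domination of `P ≥ 0`: negative term `n0`, common denominator `ud`, competitors -/
  | dom (P : PolySpec) (n0 : ℕ) (ud : ℕ) (comps : List Comp)

/-- Check an LP (Farkas) certificate: balance of exponents and `∏ Bden^N > ∏ Bnum^N`. [folklore] -/
def lpOK (c : Ctx) (rows : List (RowSpec × ℕ)) : Bool :=
  match buildRows c rows with
  | none => false
  | some rs =>
    let acc := accumulate rs
    decide (acc.1 = acc.2.1) && decide (denZ acc.2.2 < numZ acc.2.2)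

/-- Check one competitor of a domination certificate. [folklore] -/
def compOK (c : Ctx) (P : List Term) (n0 ud : ℕ) (cp : Comp) : Bool :=
  match buildRows c cp.rows with
  | none => false
  | some rs =>
    let acc := accumulate rs
    let T0 := P.getD n0 (0, [])
    let Tk := P.getD cp.k (0, [])
    let A := divF (mulF acc.2.2 [(cp.un * T0.1.natAbs, cp.D)] 1) [(Tk.1.natAbs * ud, cp.D)] 1
    decide (0 < cp.D) && decide (0 < cp.un) &&
      decide (bumps acc.1 (posl c.ordS T0.2) cp.D = bumps acc.2.1 (posl c.ordS Tk.2) cp.D) &&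
      decide (denZ A ≤ numZ A)

/-- Check a domination certificate. [folklore] -/
def domOK (c : Ctx) (P : PolySpec) (n0 ud : ℕ) (comps : List Comp) : Bool :=
  let poly := P.poly
  let pos := posTerms c poly
  P.valid && defOK c P && decide (n0 < poly.length) && !termZero c (poly.getD n0 (0, [])) && termNeg c (poly.getD n0 (0, [])) &&
    decide (0 < ud) &&
    decide (∀ k ∈ pos, ∃ cp ∈ comps, cp.k = k) && decide (∀ cp ∈ comps, cp.k ∈ pos) &&
    decide ((comps.map Comp.k).Nodup) &&
    decide ((comps.map Comp.un).sum < ud) &&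
    comps.all (compOK c poly n0 ud)

/-- Check an odd definite triangle: three definite letters, the three edge atoms non-zero with an odd number of negatives. [folklore] -/
def signOK (c : Ctx) (i j k : ℕ) : Bool :=
  decide (i < j ∧ j < k ∧ k < 6) && atomPos c (qA i) && atomPos c (qA j) && atomPos c (qA k) &&
    !atomZero c (cA i j) && !atomZero c (cA j k) && !atomZero c (cA i k) &&
    oddTrues [negSlot c.s c.br c.pstar (c.slot (cA i j)), negSlot c.s c.br c.pstar (c.slot (cA j k)),
      negSlot c.s c.br c.pstar (c.slot (cA i k))]

/-- Check an odd triangle through a NULL letter `n` (its `q n` is the zero atom) and definite letters `a < b`. [folklore] -/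
def signNullOK (c : Ctx) (n a b : ℕ) : Bool :=
  decide (n < 6 ∧ a < b ∧ b < 6 ∧ n ≠ a ∧ n ≠ b) && atomZero c (qA n) && atomPos c (qA a) && atomPos c (qA b) &&
    !atomZero c (cA n a) && !atomZero c (cA a b) && !atomZero c (cA n b) &&
    oddTrues [negSlot c.s c.br c.pstar (c.slot (cA n a)), negSlot c.s c.br c.pstar (c.slot (cA a b)),
      negSlot c.s c.br c.pstar (c.slot (cA n b))]

/-- Check an all-negative certificate: the inequality is valid, some term survives the zero atom, every surviving term is negative. [folklore] -/
def allnegOK (c : Ctx) (P : PolySpec) : Bool :=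
  let live := P.poly.filter fun T => !termZero c T
  P.valid && defOK c P && decide (live ≠ []) && live.all (termNeg c)

/-- Check a certificate for a cell. [folklore] -/
def certOK (c : Ctx) : Cert → Bool
  | .sign i j k => signOK c i j k
  | .signNull n a b => signNullOK c n a b
  | .allneg P => allnegOK c P
  | .lp rows => lpOK c rows
  | .dom P n0 ud comps => domOK c P n0 ud comps

/-- The twelve cells of a support: orientation `+` with the six branches, then orientation `−`. [folklore] -/
def cells : List (Bool × Br) := (allBr.map fun b => (true, b)) ++ (allBr.map fun b => (false, b))

/-- Check the certificates of the twelve cells against their contexts. [folklore] -/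
def cellsOK (d : List ℕ) (ord : List Atom) (pstar : ℕ) : List (Bool × Br) → List Cert → Bool
  | [], [] => true
  | (s, br) :: sb, ct :: cs => certOK (mkCtx d ord pstar s br) ct && cellsOK d ord pstar sb cs
  | _, _ => false

/-- Check a support: compute and verify the order with its tie, then all twelve cells. [folklore] -/
def checkSupport (d : List ℕ) (certs : List Cert) : Bool :=
  let ord := sortAtoms d
  let pstar := findTie d ord
  ordOK d ord pstar && cellsOK d ord pstar cells certs

/-- A table line: a support with its twelve certificates. [folklore] -/
abbrev Line := List ℕ × List Cert

/-- Check a table against its key list: keys match and every line passes. [folklore] -/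
def tableOK (keys : List (List ℕ)) (T : List Line) : Bool :=
  decide (T.map (fun l => l.1) = keys) && T.all fun l => checkSupport l.1 l.2

/-! ## The box: sorted supports with exactly `20` distinct pair sums, cover by slices with an exception list -/

/-- Number of distinct entries of a list of naturals (quadratic, bare recursion). [folklore] -/
def countDistinct : List ℕ → ℕ
  | [] => 0
  | a :: l => if V20.freshIn a l then countDistinct l + 1 else countDistinct l

/-- Does the six-element support have exactly `20` distinct pair sums (one collision)? [folklore] -/
def oneColl (d : List ℕ) : Bool := countDistinct (psums6 d) == 20

/-- Cover check of one support `[0] ++ l ++ [e, f]` with an exception list: not a one-collision support, or excluded, or a key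
(bucket `kd`), or the mirror of a key (bucket `km`). [folklore] -/
def coverCellX (exc kd km : List (List ℕ)) (f e : ℕ) (l : List ℕ) : Bool :=
  !oneColl (0 :: (l ++ [e, f])) || exc.contains (0 :: (l ++ [e, f])) || kd.contains (0 :: (l ++ [e, f])) ||
    km.contains (mirror (0 :: (l ++ [e, f])))

/-- Cover check (with exceptions) of the supports with `d₄ = e`, `d₅ = f` (key buckets: `d₄ = e`, resp. `d₁ = f − e`). [folklore] -/
def coverRowX (exc keys : List (List ℕ)) (f e : ℕ) : Bool :=
  (incLists 3 1 (e - 1)).all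
    (coverCellX exc ((keysTop keys f).filter fun k => k.getD 4 0 == e)
      ((keysTop keys f).filter fun k => k.getD 1 0 == f - e) f e)

/-- Cover check (with exceptions) of one slice `(f, elo, ehi)`: all supports with `d₅ = f`, `elo ≤ d₄ ≤ ehi`. [folklore] -/
def coverSliceX (exc keys : List (List ℕ)) (sl : ℕ × ℕ × ℕ) : Bool :=
  (List.range' sl.2.1 (sl.2.2 + 1 - sl.2.1)).all fun e => coverRowX exc keys sl.1 e

/-- Cover check (with exceptions) of a list of slices. [folklore] -/
def coverSlicesX (exc keys : List (List ℕ)) (L : List (ℕ × ℕ × ℕ)) : Bool := L.all (coverSliceX exc keys)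

end Summit.ValiantsHypothesis.ValiantsHypothesis.Theorems.LacunarySymmetroidMatrixDescartes.Census.V19C
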